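import Summits.Ventures.PercRepro.RankLevelSetLevelFiveSharpX
import Summits.Ventures.PercRepro.S2SharpCoreXQ
import Summits.Ventures.PercRepro.S2SharpCoreXQI
import Summits.Ventures.PercRepro.S2CellsP21XQI
import Summits.Ventures.PercRepro.S2MidFlatsSeven
import Summits.Ventures.PercRepro.S2MidFlatsTenB
import Summits.Ventures.PercRepro.S2CellsP21X
import Summits.Ventures.PercRepro.S2TailP21X
import Summits.Ventures.PercRepro.S2CellsP21XQ
import Summits.Ventures.PercRepro.S2CellsP21XM7
import Summits.Ventures.PercRepro.S2CellsP21XM10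
import Summits.Ventures.PercRepro.S2CoreTwentyOne

/-!
# PercRepro — THEOREM C₅ AT `22` (p7, gen 4; sub-claim S2; the «22» kit's assembly)

The `p = 21` row of the `e`-free core at level `5`: the cells `(21, d)` for `d ∈ {9, 11, …, 28}` (S2CellsP21X / S2TailP21X),
`(21, 6)` with the level-`4` tail (S2SharpCoreXQ + S2CellsP21XQ), `(21, 8)` with `N_mid = 7·C(12, 6)` (S2MidFlatsSeven +
S2CellsP21XM7), `(21, 10)` with `N_mid = 136,092` (S2MidFlatsTenB + S2CellsP21XM10), the coranks `≥ 29` by the sum key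
(S2CoreTwentyOne) — and the cell `(21, 7)`, `1.0148` with every other lever, closed at `0.9959` by the independent `5`-sets
corrected by the triangles (S2IndepFiveCount: `#{independent 5-sets} ≤ C(n, 5) − s₃·C(n − 3, 2) + C(s₃, 2)`; the core
S2SharpCoreXQI, the numerals S2CellsP21XQI). With the «23» chain (`c025_five_large_sharp23`, RankLevelSetLevelFiveSharpX):

* **`c025_core_five_twentyone_seven`** — the `e`-free core at level `5`, rank `21`, corank `7`;
* **`c025_core_five_twentyone_xx`** — the `e`-free core at level `5`, rank `21`, every corank `6 ≤ d ≤ 28`;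
* **`c025_five_of_four_sharp_xx_from`** — for `P ≥ 21`, level `4` for all `p ≥ P` implies level `5` for all `p ≥ P + 1`;
* **`c025_five_large_sharp22`** — UNCONDITIONAL over the landed tree: C-025 at level `5` for every `p ≥ 22` (level `4`
  from S1's `c025_four_seventeen`); `c025_five_large_sharp22'` is the `C025` spelling.
Axioms: standard. -/

open scoped Matroid

namespace PercRepro

namespace S2

/-- **The `p = 21` cells, dispatched**: for every corank `6 ≤ d ≤ 28`, `d ∉ {6, 7, 8, 10}`, some slack `m ≤ 1024` with
`1024·U′(21, d) ≤ (1024 − m)·2^(d−5)·C(26, 5)` and `1024·T′(21 + d, d) ≤ m·2^(21+d)`. -/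
theorem cellsP21X (d : ℕ) (hd6 : 6 ≤ d) (hd28 : d ≤ 28) (hn6 : d ≠ 6) (hn7 : d ≠ 7) (hn8 : d ≠ 8) (hn10 : d ≠ 10) :
    ∃ m : ℕ, m ≤ 1024 ∧
      (1024 * (((21 + d).choose 5 : ℚ) +
      (∑ j ∈ Finset.range (d - 5), (Nat.choose (min 13 ((d + 6) / 2 + 1 - 2)) j : ℚ) / (((j + 1) + 3 * (j + 1).choose 2 : ℕ) : ℚ)) *
        ((((d * d + 6 - 3 * d) / 2) * (21 + d - 3).choose 3 + S1.fourCircuitBound d * (21 + d - 4).choose 2 + (d + 4).choose 5 * (21 + d - 5) + (d + 5).choose 6 : ℕ) : ℚ) +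
      ((∑ j ∈ Finset.range (d - 5), (Nat.choose (min 19 (5 + d) - 6) j : ℚ) / (((j + 1) + 3 * (j + 1).choose 2 : ℕ) : ℚ)) -
        (∑ j ∈ Finset.range (d - 5), (Nat.choose (min 13 ((d + 6) / 2 + 1 - 2)) j : ℚ) / (((j + 1) + 3 * (j + 1).choose 2 : ℕ) : ℚ))) *
        ((min 19 (5 + d)).choose 6 : ℚ)) ≤
        ((1024 - m : ℕ) : ℚ) * 2 ^ (d - 5) * ((21 + 5).choose 5 : ℚ)) ∧
      (1024 * ((((21 + d).choose 4 * 2 ^ 6 + (21 + d).choose 3 * 2 ^ 3 + (21 + d).choose 2 * 2 + (21 + d) + 1 : ℕ) : ℚ) +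
      (((21 + d).choose 5 : ℚ) + (∑ j ∈ Finset.range (d), (Nat.choose (min 13 ((d + 6) / 2 + 1 - 2)) j : ℚ) / (((j + 1) + 3 * (j + 1).choose 2 : ℕ) : ℚ)) * ((((d * d + 6 - 3 * d) / 2) * (21 + d - 3).choose 3 + S1.fourCircuitBound d * (21 + d - 4).choose 2 + (d + 4).choose 5 * (21 + d - 5) + (d + 5).choose 6 : ℕ) : ℚ) +
        ((∑ j ∈ Finset.range (d), (Nat.choose (min 19 (5 + d) - 6) j : ℚ) / (((j + 1) + 3 * (j + 1).choose 2 : ℕ) : ℚ)) - (∑ j ∈ Finset.range (d), (Nat.choose (min 13 ((d + 6) / 2 + 1 - 2)) j : ℚ) / (((j + 1) + 3 * (j + 1).choose 2 : ℕ) : ℚ))) * ((min 19 (5 + d)).choose 6 : ℚ)) +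
      ((∑ j ∈ Finset.range (d + 1), (21 + d).choose j : ℕ) : ℚ)) ≤ (m : ℚ) * 2 ^ (21 + d)) := by
  interval_cases d
  · exact absurd rfl hn6
  · exact absurd rfl hn7
  · exact absurd rfl hn8
  · exact ⟨25, by norm_num, cellP21X_poly_9, cellP21X_tail_9⟩
  · exact absurd rfl hn10
  · exact ⟨58, by norm_num, cellP21X_poly_11, cellP21X_tail_11⟩
  · exact ⟨85, by norm_num, cellP21X_poly_12, cellP21X_tail_12⟩
  · exact ⟨119, by norm_num, cellP21X_poly_13, cellP21X_tail_13⟩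
  · exact ⟨160, by norm_num, cellP21X_poly_14, cellP21X_tail_14⟩
  · exact ⟨208, by norm_num, cellP21X_poly_15, cellP21X_tail_15⟩
  · exact ⟨263, by norm_num, cellP21X_poly_16, cellP21X_tail_16⟩
  · exact ⟨322, by norm_num, cellP21X_poly_17, cellP21X_tail_17⟩
  · exact ⟨384, by norm_num, cellP21X_poly_18, cellP21X_tail_18⟩
  · exact ⟨448, by norm_num, cellP21X_poly_19, cellP21X_tail_19⟩
  · exact ⟨513, by norm_num, cellP21X_poly_20, cellP21X_tail_20⟩
  · exact ⟨575, by norm_num, cellP21X_poly_21, cellP21X_tail_21⟩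
  · exact ⟨635, by norm_num, cellP21X_poly_22, cellP21X_tail_22⟩
  · exact ⟨691, by norm_num, cellP21X_poly_23, cellP21X_tail_23⟩
  · exact ⟨742, by norm_num, cellP21X_poly_24, cellP21X_tail_24⟩
  · exact ⟨788, by norm_num, cellP21X_poly_25, cellP21X_tail_25⟩
  · exact ⟨829, by norm_num, cellP21X_poly_26, cellP21X_tail_26⟩
  · exact ⟨865, by norm_num, cellP21X_poly_27, cellP21X_tail_27⟩
  · exact ⟨895, by norm_num, cellP21X_poly_28, cellP21X_tail_28⟩

end S2

namespace ThmN

open Set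

variable {α : Type}

/-- **The `e`-free core at level `5`, rank `21`, corank `7`**: the cell `(21, 7)` with the level-`4` tail and the
independent `5`-sets corrected by the triangles (slack `9/1024`). -/
theorem c025_core_five_twentyone_seven (M : Matroid α) [M.Finite]
    (hR : M.eRank = ((21 : ℕ) : ℕ∞)) (hn : M.E.ncard = 21 + 7)
    (hfree : ∀ e ∈ M.E, ∃ A ⊆ M.E \ {e}, e ∉ M.closure A ∧ e ∉ M.closure ((M.E \ {e}) \ A)) :
    RLS M 21 5 :=
  c025_core_five_sharp_cell_xqi M 21 7 (by norm_num) (by norm_num) hR hn hfree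
    ⟨9, by norm_num, S2.cellP21XQI_poly_7, S2.cellP21XQI_tail_7⟩

/-- **The `e`-free core at level `5`, rank `21`, corank `8`**: the mid spanning sets number `≤ 7·C(12, 6)`
(S2MidFlatsSeven), and the cell `(21, 8)` closes with the mid class explicit. -/
theorem c025_core_five_twentyone_eight (M : Matroid α) [M.Finite]
    (hR : M.eRank = ((21 : ℕ) : ℕ∞)) (hn : M.E.ncard = 21 + 8)
    (hfree : ∀ e ∈ M.E, ∃ A ⊆ M.E \ {e}, e ∉ M.closure A ∧ e ∉ M.closure ((M.E \ {e}) \ A)) :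
    RLS M 21 5 := by
  have hL0 : ∀ e ∈ M.E, ¬ M.IsLoop e := not_isLoop_of_free M hfree
  have hd : M.E.encard = M.eRank + 8 := by
    rw [hR, ← M.ground_finite.cast_ncard_eq, hn]
    push_cast
    ring
  have hflat' : ∀ X ⊆ M.E, M.eRk X ≤ ((5 - 1 : ℕ) : ℕ∞) → X.ncard ≤ 10 := fun X hX hr =>
    ncard_le_ten_of_eRk_le_four_of_free M hfree hX (by simpa using hr)
  have hC2 : ∀ P ⊆ M.E, M.eRk P ≤ 3 → P.ncard ≤ 6 :=
    fun P hP hr => ncard_le_six_of_eRk_le_three_of_free M hfree hP hr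
  have hC0 : ∀ X ⊆ M.E, M.eRk X ≤ 1 → X.ncard ≤ 1 := fun X hX hr => by
    have := ncard_add_one_le_two_pow_of_eRk_le M hL0 hfree 1 X hX hr
    omega
  have hmid := S2.card_spanMid_le_seven hflat' hC2 hC0 hd
  have hmid' : (S2.spanMid M 5 (min 10 (4 + 8)) ((8 + 6) / 2 + 1)).card ≤ 7 * (12).choose 6 := by
    rw [show min 10 (4 + 8) = 10 by norm_num, show (8 + 6) / 2 + 1 = 8 by norm_num]
    exact hmid
  have key := c025_core_five_sharp_cell_xmid M 21 8 (7 * (12).choose 6) (by norm_num) hR hn hfree hmid'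
  exact key S2.cellP21XM7

/-- **The `e`-free core at level `5`, rank `21`, corank `10`**: the mid spanning sets number `≤ 136,092`
(S2MidFlatsTenB), and the cell `(21, 10)` closes with the mid class explicit. -/
theorem c025_core_five_twentyone_ten (M : Matroid α) [M.Finite]
    (hR : M.eRank = ((21 : ℕ) : ℕ∞)) (hn : M.E.ncard = 21 + 10)
    (hfree : ∀ e ∈ M.E, ∃ A ⊆ M.E \ {e}, e ∉ M.closure A ∧ e ∉ M.closure ((M.E \ {e}) \ A)) :
    RLS M 21 5 := by
  have hL0 : ∀ e ∈ M.E, ¬ M.IsLoop e := not_isLoop_of_free M hfree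
  have hd : M.E.encard = M.eRank + 10 := by
    rw [hR, ← M.ground_finite.cast_ncard_eq, hn]
    push_cast
    ring
  have hs : ∀ e ∈ M.E, ∀ f ∈ M.E, e ≠ f → M.eRk {e, f} = 2 := by
    intro e he f hf hef
    have h2 : (2 : ℕ∞) ≤ M.eRk {e, f} :=
      two_le_eRk_of_two_le_ncard_of_free M hfree (pair_subset he hf) (by rw [ncard_pair hef])
    have h3 : M.eRk {e, f} ≤ 2 := by
      have := M.eRk_le_encard {e, f}
      rwa [encard_pair hef] at this
    exact le_antisymm h3 h2
  have hC1 : ∀ L ⊆ M.E, M.eRk L = 2 → L.ncard ≤ 3 :=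
    fun L hL hr => ncard_le_three_of_eRk_two M hs hfree hL hr
  have hflat' : ∀ X ⊆ M.E, M.eRk X ≤ ((5 - 1 : ℕ) : ℕ∞) → X.ncard ≤ 10 := fun X hX hr =>
    ncard_le_ten_of_eRk_le_four_of_free M hfree hX (by simpa using hr)
  have hC2 : ∀ P ⊆ M.E, M.eRk P ≤ 3 → P.ncard ≤ 6 :=
    fun P hP hr => ncard_le_six_of_eRk_le_three_of_free M hfree hP hr
  have hC0 : ∀ X ⊆ M.E, M.eRk X ≤ 1 → X.ncard ≤ 1 := fun X hX hr => by
    have := ncard_add_one_le_two_pow_of_eRk_le M hL0 hfree 1 X hX hr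
    omega
  have hmid := S2.card_spanMid_le_ten hC1 hflat' hC2 hC0 hd hn
  have hmid' : (S2.spanMid M 5 (min 10 (4 + 10)) ((10 + 6) / 2 + 1)).card ≤ 136092 := by
    rw [show min 10 (4 + 10) = 10 by norm_num, show (10 + 6) / 2 + 1 = 9 by norm_num]
    exact hmid
  have key := c025_core_five_sharp_cell_xmid M 21 10 136092 (by norm_num) hR hn hfree hmid'
  exact key S2.cellP21XM10

/-- **The `e`-free core at level `5`, rank `21`, corank `6`**: the cell `(21, 6)` with the level-`4` tail. -/
theorem c025_core_five_twentyone_six (M : Matroid α) [M.Finite]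
    (hR : M.eRank = ((21 : ℕ) : ℕ∞)) (hn : M.E.ncard = 21 + 6)
    (hfree : ∀ e ∈ M.E, ∃ A ⊆ M.E \ {e}, e ∉ M.closure A ∧ e ∉ M.closure ((M.E \ {e}) \ A)) :
    RLS M 21 5 :=
  c025_core_five_sharp_cell_xq M 21 6 (by norm_num) hR hn hfree
    ⟨6, by norm_num, S2.cellP21XQ_poly_6, S2.cellP21XQ_tail_6⟩

/-- **The `e`-free core at level `5`, rank `21`, every corank `6 ≤ d ≤ 28`**. -/
theorem c025_core_five_twentyone_xx (M : Matroid α) [M.Finite] (d : ℕ)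
    (hd6 : 6 ≤ d) (hd28 : d ≤ 28) (hR : M.eRank = ((21 : ℕ) : ℕ∞)) (hn : M.E.ncard = 21 + d)
    (hfree : ∀ e ∈ M.E, ∃ A ⊆ M.E \ {e}, e ∉ M.closure A ∧ e ∉ M.closure ((M.E \ {e}) \ A)) :
    RLS M 21 5 := by
  by_cases h6 : d = 6
  · subst h6; exact c025_core_five_twentyone_six M hR hn hfree
  by_cases h7' : d = 7
  · subst h7'; exact c025_core_five_twentyone_seven M hR hn hfree
  by_cases h8 : d = 8
  · subst h8; exact c025_core_five_twentyone_eight M hR hn hfree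
  by_cases h10 : d = 10
  · subst h10; exact c025_core_five_twentyone_ten M hR hn hfree
  exact c025_core_five_sharp_cell_x M 21 d hd6 hR hn hfree (S2.cellsP21X d hd6 hd28 h6 h7' h8 h10)

/-- **THEOREM C₅, GIVEN LEVEL `4` FROM `P ≥ 21`**: level `4` for all `p ≥ P` implies level `5` for all `p ≥ P + 1`. -/
theorem c025_five_of_four_sharp_xx_from (P : ℕ) (hP : 21 ≤ P)
    (h4 : ∀ (M : Matroid α) [M.Finite] (p : ℕ), P ≤ p → RLS M p 4) :
    ∀ (M : Matroid α) [M.Finite] (p : ℕ), P + 1 ≤ p → RLS M p 5 := by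
  refine S2.rls_five_of_four_of_core P (by omega) h4 ?_
  intro M _ p hP' hR hbig hfree
  rcases Nat.lt_or_ge p 22 with h21 | h22
  · have hp' : p = 21 := by omega
    subst hp'
    rcases Nat.lt_or_ge M.E.ncard (21 + 29) with h | h
    · exact c025_core_five_twentyone_xx M (M.E.ncard - 21) (by omega) (by omega) hR (by omega) hfree
    · exact c025_core_five_nineteen_at_twentyone M (by omega) hfree
  rcases Nat.lt_or_ge p 23 with h22' | h23
  · have hp' : p = 22 := by omega
    subst hp'
    rcases Nat.lt_or_ge M.E.ncard (22 + 27) with h | h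
    · exact c025_core_five_twentytwo M (M.E.ncard - 22) (by omega) (by omega) hR (by omega) hfree
    · exact c025_core_five_nineteen_at_twentytwo M (by omega) hfree
  rcases Nat.lt_or_ge p 24 with h23' | h24
  · have hp' : p = 23 := by omega
    subst hp'
    rcases Nat.lt_or_ge M.E.ncard (23 + 26) with h | h
    · exact c025_core_five_twentythree M (M.E.ncard - 23) (by omega) (by omega) hR (by omega) hfree
    · exact c025_core_five_nineteen_at_twentythree M (by omega) hfree
  rcases Nat.lt_or_ge p 25 with h24' | h25
  · have hp' : p = 24 := by omega
    subst hp'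
    rcases Nat.lt_or_ge M.E.ncard (24 + 26) with h | h
    · exact c025_core_five_twentyfour_x M (M.E.ncard - 24) (by omega) (by omega) hR (by omega) hfree
    · exact c025_core_five_nineteen_at_twentyfour M (by omega) hfree
  rcases Nat.lt_or_ge p 26 with h25' | h26
  · have hp' : p = 25 := by omega
    subst hp'
    rcases Nat.lt_or_ge M.E.ncard (25 + 26) with h | h
    · exact c025_core_five_twentyfive_cells M (M.E.ncard - 25) (by omega) (by omega) hR (by omega) hfree
    · exact c025_core_five_nineteen_at_twentyfive M (by omega) hfree
  rcases Nat.lt_or_ge M.E.ncard (p + 26) with h | h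
  · exact c025_core_five_sharp_cells M p (M.E.ncard - p) h26 (by omega) (by omega) hR (by omega) hfree
  · rcases Nat.lt_or_ge p 27 with h27 | h27
    · have hp' : p = 26 := by omega
      subst hp'
      exact c025_core_five_nineteen_at_twentysix M (by omega) hfree
    · exact c025_core_five_nineteen M p h27 hR (by omega) hfree

/-- **THEOREM C₅ AT `22`**: every finite matroid satisfies C-025 at level `5` for every `p ≥ 22` (level `4` from S1's
`c025_four_seventeen`). -/
theorem c025_five_large_sharp22 (M : Matroid α) [M.Finite] (p : ℕ) (hp : 22 ≤ p) : RLS M p 5 :=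
  c025_five_of_four_sharp_xx_from 21 le_rfl (fun M _ p hp => S1.c025_four_seventeen M p (by omega)) M p hp

/-- The level-`5` statement at `p ≥ 22` in the vocabulary of `C025`. -/
theorem c025_five_large_sharp22' (M : Matroid α) [M.Finite] (p : ℕ) (hp : 22 ≤ p) :
    phiK p 5 * ({A : Set α | A ⊆ M.E ∧ M.eRk A = (p : ℕ∞) ∧ M.eRk (M.E \ A) = (5 : ℕ∞)}.ncard : ℚ) ≤
      ({A : Set α | A ⊆ M.E ∧ (5 : ℕ∞) < M.eRk A ∧ M.eRk A < (p : ℕ∞)}.ncard : ℚ) :=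
  c025_five_large_sharp22 M p hp

end ThmN

end PercRepro
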